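import Summits.ResolutionOfSingularities.ResolutionOfSingularities.Theorems.UniformComplexityCampaignW82SeparableTightnessTwistedCore
import Summits.ResolutionOfSingularities.ResolutionOfSingularities.Theorems.UniformComplexityCampaignW82SeparableTightnessCompactification
import Summits.ResolutionOfSingularities.ResolutionOfSingularities.Theorems.UniformComplexityCampaignW82TwistExponentBaseChange
import Summits.ResolutionOfSingularities.ResolutionOfSingularities.Theorems.UniformComplexityCampaignW82TwistExponentUnbounded
import Literature.AlgebraicGeometry.Resolution.AlterationsDimension
import Mathlib.RingTheory.Polynomial.IrreducibleRing
import Mathlib.Algebra.CharP.Algebra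
import Mathlib.Topology.KrullDimension
import HarnessLib

/-!
# [OURS · L1 W8.2] Separable tightness, TWISTED: the inseparable exponent of resolving base extensions is
# unbounded across families of curves over `k[t]`

Cell `res-hironaka` (run/shared/lean/pub/res-hironaka/), LADDER-RESOLUTION rung L (RESCUE), slot W8.2, door 2
(`UniformComplexity`, host item `PrimeModelTransfer` stmt-ResolutionOfSingularities-8933); prover res-L1-s82-pv-2
(gen 7). THESES-FREE module (imports the gen-7 siblings `…SeparableTightnessTwistedCore` (p563933:
`false_of_isRegular_pullback_proper_isoOver_pow`), `…SeparableTightnessCompactification` (p558256) — hence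
`…SeparableTightnessPencil` (p556612) —, the gen-3 files `…TwistExponentBaseChange` / `…TwistExponentUnbounded`
(`isDomain_twistRing'`, `prime_twistPoly'`, `topologicalKrullDim_twistCurve_le_one`, `altPrime`), the tree file
`Literature.AlgebraicGeometry.Resolution.AlterationsDimension` (dimension of a dense open), Mathlib, `HarnessLib`).

THE RESULT. The separable tightness (`not_familyResolutionSep`, headline file) says: in RESOLUTION IN FAMILIES
(`CampaignW82.FamilyResolution`, p526769) the base extension `A → A'` must adjoin `t^{1/p}` for the Kollár pencil.
Here the TWISTED pencils `y^q = x^{p^{e+1}} − t` over `k[t]` show that NO BOUND on the inseparable exponent works: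

* **`inseparable_exponent_unbounded k p e`** — for every field `k` of characteristic `p` and every `e : ℕ` there is a
  PROPER family `𝒳 → Spec k[t]` with INTEGRAL geometric generic fibre of DIMENSION `≤ 1` (inside the hypothesis
  class of `FamilyResolution` and of its TRUE grade `FamilyResolutionDimLe k 1`, p531789) such that every injective
  `k[t] → A'` (domain) and every `G : 𝒴 → 𝒳 ×_{k[t]} Spec A'` whose fibres over the generic and the geometric
  generic point of `Spec A'` are weak resolutions force `t ∈ (Frac A')^{p^{e+1}}`.
* `exists_pow_pow_eq_of_isWeakResolution_generic_fibres` — the invariant form for the pencil `y^q = x^{p^a} − t` over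
  any domain `A` of characteristic `p`: the resolving base extracts a `p^a`-th root of `t`.
* `false_of_isWeakResolution_two_fibres_pow'` — the two-fibre obstruction for the twisted pencil over an arbitrary
  base change `S' → Spec A` (hypothesis: `φ₀ t` has no `p^a`-th root in `K'`; root descent `exists_root_irreducible`
  to `s = t^{1/p^j}` with `X^p − s` irreducible, identity `twistPoly_root_pow`, twisted core p563933).
* `isIntegral_pullback_pencil_of_not_dvd`, `isIntegral_and_dim_le_one_of_pencil_dense` — the gen-7 pencil lemmas
  for a non-prime exponent `P` with `q ∤ P`.

READING (numbers, not adjectives). Family-level form of gen 3's «NO BOUNDED FROBENIUS-TWIST EXPONENT» (p510058,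
p513490; there: over `M(t)`, fibrewise): across proper families of CURVES over the fixed base `k[t]` — all inside
the class where resolution in families HOLDS after an algebraic base extension (p531789) — the purely inseparable
part of the resolving base extension must have exponent `≥ e + 1` for the `e`-th twisted pencil; so the base
extension in `FamilyResolution` cannot be chosen of bounded inseparable exponent in terms of `(p, fibre dimension)`.
No claim about the crux (open problem).

HONEST FRAMING. OURS negative-side bookkeeping; NOT a statement of H. Hironaka's 2017 manuscript ([Hironaka2017]);
nothing here is attributed to its author. AI work, weaker than expert review.

## References (vocabulary and locators only)
* J. Kollár, *Lectures on Resolution of Singularities* (2007), 1.19. [Kollar2007]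
* U. Görtz, T. Wedhorn, *Algebraic Geometry I* (2020), Thm. 5.22 (3). [GortzWedhorn2020]
* The Stacks Project, Tags 02VL, 0CMK. [StacksProject]
-/

noncomputable section

set_option linter.dupNamespace false -- mandated namespace of this single-conjunct summit

open Polynomial
open _root_.CategoryTheory _root_.CategoryTheory.Limits _root_.AlgebraicGeometry _root_.TopologicalSpace
open Literature.AlgebraicGeometry.Resolution

namespace Summit.ResolutionOfSingularities.ResolutionOfSingularities.Theorems.CampaignW82.SeparableTightness

/-! ## §1 The twisted pencils `y^q = x^P − t` (`q ∤ P`): integrality and dimension of flat fibres -/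

section TwistedPencil

variable {A : Type} [CommRing A] (P : ℕ) (t : A) (q : ℕ)

/-- The base change of the pencil `y^q = x^P − t` to a field is integral whenever `0 < P`, `q ∤ P` (gen 3
`TwistExponent.isDomain_twistRing'`, no primality of `P` needed). [folklore] -/
theorem isIntegral_pullback_pencil_of_not_dvd [Fact q.Prime] (hP : 0 < P) (hqP : ¬ q ∣ P)
    {L : Type} [Field L] (φ : A →+* L) :
    IsIntegral (pullback (pencilTo A P t q) (Spec.map (CommRingCat.ofHom φ))) := by
  haveI : IsDomain (TwistExponent.TwistRing L P (φ t) q 1) :=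
    TwistExponent.isDomain_twistRing' (K := L) (P := P) (t := φ t) (q := q) hP hqP (N := 1)
      (fun h => (Fact.out : q.Prime).ne_one (Nat.dvd_one.mp h))
  haveI : Nonempty ↥(pullback (pencilTo A P t q) (Spec.map (CommRingCat.ofHom φ))) :=
    ⟨(pullbackPencilIso A P t q φ).inv (⊥ : PrimeSpectrum _)⟩
  exact isIntegral_of_isOpenImmersion (pullbackPencilIso A P t q φ).hom

/-- Flat field-valued fibres of a family containing the pencil `y^q = x^P − t` (`0 < P`, `q ∤ P`) densely are
integral, and of dimension `≤ 1` (as `isIntegral_pullback_of_pencil_dense` /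
`topologicalKrullDim_pullback_le_one_of_pencil_dense`, without primality of the exponent). [cite: GortzWedhorn2020, Thm. 5.22 (3)] -/
theorem isIntegral_and_dim_le_one_of_pencil_dense [Fact q.Prime] (hP : 0 < P) (hqP : ¬ q ∣ P)
    {𝒳 : Scheme.{0}} (f : 𝒳 ⟶ Spec (.of A)) [LocallyOfFiniteType f]
    (j : pencil A P t q ⟶ 𝒳) [IsOpenImmersion j] [QuasiCompact j] [IsSchemeTheoreticallyDominant j]
    (hj : j ≫ f = pencilTo A P t q) {L : Type} [Field L] (φ₀ : A →+* L) (hflat : φ₀.Flat) :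
    IsIntegral (pullback f (Spec.map (CommRingCat.ofHom φ₀))) ∧
      topologicalKrullDim ↥(pullback f (Spec.map (CommRingCat.ofHom φ₀))) ≤ 1 := by
  set b := pullback.fst f (Spec.map (CommRingCat.ofHom φ₀)) with hb
  haveI : Flat (Spec.map (CommRingCat.ofHom φ₀)) := (HasRingHomProperty.Spec_iff (P := @Flat)).mpr hflat
  haveI : Flat b := inferInstance
  have sq₀ : IsPullback b (pullback.snd f (Spec.map (CommRingCat.ofHom φ₀))) f
      (Spec.map (CommRingCat.ofHom φ₀)) := IsPullback.of_hasPullback _ _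
  have sqP : IsPullback (pullback.fst j b) (pullback.snd j b) j b := IsPullback.of_hasPullback j b
  have sqP' : IsPullback (pullback.fst j b) (pullback.snd j b ≫ pullback.snd f (Spec.map (CommRingCat.ofHom φ₀)))
      (pencilTo A P t q) (Spec.map (CommRingCat.ofHom φ₀)) := by
    rw [← hj]; exact sqP.paste_vert sq₀
  let eP : pullback j b ≅ TwistExponent.twistCurve L P (φ₀ t) q 1 :=
    sqP'.isoPullback ≪≫ pullbackPencilIso A P t q φ₀
  haveI : IsIntegral (pullback (pencilTo A P t q) (Spec.map (CommRingCat.ofHom φ₀))) :=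
    isIntegral_pullback_pencil_of_not_dvd P t q hP hqP φ₀
  haveI : Nonempty ↥(pullback j b) := ⟨sqP'.isoPullback.inv (Classical.arbitrary _)⟩
  haveI : IsIntegral (pullback j b) := isIntegral_of_isOpenImmersion sqP'.isoPullback.hom
  haveI : IsIntegral (pullback f (Spec.map (CommRingCat.ofHom φ₀))) := isIntegral_of_flat_of_isPullback j b sqP
  refine ⟨inferInstance, ?_⟩
  have hq1 : ¬ q ∣ 1 := fun h => (Fact.out : q.Prime).ne_one (Nat.dvd_one.mp h)
  haveI : IsDomain (TwistExponent.TwistRing L P (φ₀ t) q 1) :=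
    TwistExponent.isDomain_twistRing' (K := L) (P := P) (t := φ₀ t) (q := q) hP hqP (N := 1) hq1
  have hT : topologicalKrullDim ↥(TwistExponent.twistCurve L P (φ₀ t) q 1) ≤ 1 :=
    TwistExponent.topologicalKrullDim_twistCurve_le_one (K := L) (P := P) (t := φ₀ t) (q := q)
      (TwistExponent.prime_twistPoly' (K := L) (P := P) (t := φ₀ t) (q := q) hP hqP hq1).ne_zero
  have h1 : topologicalKrullDim ↥(pullback j b) =
      topologicalKrullDim ↥(pullback f (Spec.map (CommRingCat.ofHom φ₀))) :=
    topologicalKrullDim_eq_of_isOpenImmersion (pullback.snd f (Spec.map (CommRingCat.ofHom φ₀)))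
      (pullback.snd j b)
  have h2 : topologicalKrullDim ↥(TwistExponent.twistCurve L P (φ₀ t) q 1) = topologicalKrullDim ↥(pullback j b) :=
    topologicalKrullDim_eq_of_isOpenImmersion
      (pullback.snd j b ≫ pullback.snd f (Spec.map (CommRingCat.ofHom φ₀))) eP.inv
  rw [← h1, ← h2]
  exact hT

end TwistedPencil

/-! ## §2 The two-fibre obstruction for the twisted pencils -/

section TwoFibresPow

variable {A : Type} [CommRing A] (p : ℕ) (t : A) (q : ℕ)

/-- In characteristic `p`: `X₀^q − (X₁^{p^{m+1+j}} − s^{p^j}) = X₀^q − (X₁^{p^{m+1}} − s)^{p^j}`. [folklore] -/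
theorem twistPoly_root_pow {K : Type} [Field K] [Fact p.Prime] [CharP K p] (s : K) (m j : ℕ) :
    TwistExponent.twistPoly K (p ^ (m + 1 + j)) (s ^ p ^ j) q 1 =
      TwistExponent.twistPoly K (p ^ (m + 1)) s q (p ^ j) := by
  simp only [TwistExponent.twistPoly, pow_one]
  rw [sub_pow_char_pow, ← pow_mul, ← pow_add, map_pow]

/-- **Root descent.** If `t₀ ∈ K'` has NO `p^a`-th root in `K'` (`a ≥ 1`), then for some `j < a` there is
`s ∈ K'` with `s^{p^j} = t₀` and `X^p − s` irreducible over `K'` (take `j` largest with a `p^j`-th root).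
[folklore] -/
theorem exists_root_irreducible {K' : Type} [Field K'] (hp : p.Prime) (t₀ : K') {a : ℕ}
    (hroot : ∀ s : K', s ^ p ^ a ≠ t₀) :
    ∃ (m j : ℕ) (s : K'), a = m + 1 + j ∧ s ^ p ^ j = t₀ ∧ Irreducible (X ^ p - C s : K'[X]) := by
  classical
  have ha : 0 < a := by
    rcases Nat.eq_zero_or_pos a with h | h
    · exact absurd (by rw [h, pow_zero, pow_one]) (hroot t₀)
    · exact h
  let Q : ℕ → Prop := fun j => ∃ s : K', s ^ p ^ j = t₀
  have hQ0 : Q 0 := ⟨t₀, by rw [pow_zero, pow_one]⟩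
  set j := Nat.findGreatest Q (a - 1) with hjdef
  have hjQ : Q j := Nat.findGreatest_spec (P := Q) (Nat.zero_le _) hQ0
  have hjle : j ≤ a - 1 := Nat.findGreatest_le (a - 1)
  obtain ⟨s, hs⟩ := hjQ
  obtain ⟨m, hm⟩ : ∃ m, a = m + 1 + j := ⟨a - 1 - j, by omega⟩
  refine ⟨m, j, s, hm, hs, X_pow_sub_C_irreducible_of_prime hp fun u hu => ?_⟩
  have hu' : u ^ p ^ (j + 1) = t₀ := by rw [pow_succ', pow_mul, hu, hs]
  by_cases hj1 : j + 1 ≤ a - 1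
  · exact Nat.findGreatest_is_greatest (Nat.lt_succ_self j) hj1 ⟨u, hu'⟩
  · have : j + 1 = a := by omega
    exact hroot u (by rw [← this]; exact hu')

/-- **THE TWO-FIBRE OBSTRUCTION FOR THE TWISTED PENCIL `y^q = x^{p^a} − t`** (arbitrary base change
`S' → Spec A`). As `false_of_isWeakResolution_two_fibres'` (p557947) with the pencil replaced by its `(a−1)`-st
Frobenius twist and the hypothesis «`X^p − φ₀ t` irreducible» replaced by «`φ₀ t` has no `p^a`-th root in `K'`»:
if `t` has a `p^j`-th root `s` but no `p^{j+1}`-th root (`j < a`, `exists_root_irreducible`), the fibre curve is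
`y^q = x^{p^a} − s^{p^j} = (x^{p^{a−j}} − s)^{p^j}` (`twistPoly_root_pow`), and the twisted core
`false_of_isRegular_pullback_proper_isoOver_pow` applies. [cite: Kollar2007, 1.19] -/
theorem false_of_isWeakResolution_two_fibres_pow' [Fact p.Prime] [Fact q.Prime] (hqp : q ≠ p) (a : ℕ)
    {𝒳 : Scheme.{0}} (f : 𝒳 ⟶ Spec (.of A)) [LocallyOfFiniteType f]
    (j : pencil A (p ^ a) t q ⟶ 𝒳) [IsOpenImmersion j] [QuasiCompact j] [IsSchemeTheoreticallyDominant j]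
    (hj : j ≫ f = pencilTo A (p ^ a) t q)
    {S' : Scheme.{0}} (ψ' : S' ⟶ Spec (.of A))
    {K' Ω : Type} [Field K'] [CharP K' p] [Field Ω] [PerfectField Ω] (φ₀ : A →+* K') (ι : K' →+* Ω)
    (s₁ : Spec (.of K') ⟶ S') (hcomp : s₁ ≫ ψ' = Spec.map (CommRingCat.ofHom φ₀))
    (s₂ : Spec (.of Ω) ⟶ S') (hs₂ : s₂ = Spec.map (CommRingCat.ofHom ι) ≫ s₁)
    (hflat : φ₀.Flat) (hroot : ∀ s : K', s ^ p ^ a ≠ φ₀ t)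
    {𝒴 : Scheme.{0}} (G : 𝒴 ⟶ pullback f ψ')
    (h₁ : IsWeakResolution (pullback.snd G (pullback.fst (pullback.snd f ψ') s₁)))
    (h₂ : IsWeakResolution (pullback.snd G (pullback.fst (pullback.snd f ψ') s₂))) : False := by
  have hp : p.Prime := Fact.out
  have hq : q.Prime := Fact.out
  have hPpos : 0 < p ^ a := pow_pos hp.pos a
  have hqP : ¬ q ∣ p ^ a := fun h => hqp ((Nat.prime_dvd_prime_iff_eq hq hp).mp (hq.dvd_of_dvd_pow h))
  subst hs₂
  -- notation
  set f' := pullback.snd f ψ' with hf'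
  set sΩ : Spec (.of Ω) ⟶ Spec (.of K') := Spec.map (CommRingCat.ofHom ι) with hsΩ
  set c₁ := pullback.fst f' s₁ with hc₁
  set g := pullback.snd f' s₁ with hg
  set c₂ := pullback.fst f' (sΩ ≫ s₁) with hc₂
  set g₂ := pullback.snd f' (sΩ ≫ s₁) with hg₂
  set π := pullback.snd G c₁ with hπ
  set π₂ := pullback.snd G c₂ with hπ₂
  set b₁ := c₁ ≫ pullback.fst f ψ' with hb₁
  obtain ⟨hproper, -, W, hW, hiso⟩ := h₁
  have hreg₂ : Scheme.IsRegular (pullback G c₂) := h₂.isRegular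
  -- flatness of `b₁ : X₁ → 𝒳` and integrality of `X₁`
  have sq₀ : IsPullback (pullback.fst f ψ') f' f ψ' := IsPullback.of_hasPullback f ψ'
  have sq₁ : IsPullback c₁ g f' s₁ := IsPullback.of_hasPullback f' s₁
  have sqb : IsPullback b₁ g f (Spec.map (CommRingCat.ofHom φ₀)) := hcomp ▸ sq₁.paste_horiz sq₀
  haveI : Flat (Spec.map (CommRingCat.ofHom φ₀)) := (HasRingHomProperty.Spec_iff (P := @Flat)).mpr hflat
  haveI : Flat b₁ := MorphismProperty.of_isPullback (P := @Flat) sqb.flip inferInstance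
  have sqP : IsPullback (pullback.fst j b₁) (pullback.snd j b₁) j b₁ := IsPullback.of_hasPullback j b₁
  have sqP' : IsPullback (pullback.fst j b₁) (pullback.snd j b₁ ≫ g) (pencilTo A (p ^ a) t q)
      (Spec.map (CommRingCat.ofHom φ₀)) := by
    rw [← hj]; exact sqP.paste_vert sqb
  haveI : IsIntegral (pullback (pencilTo A (p ^ a) t q) (Spec.map (CommRingCat.ofHom φ₀))) :=
    isIntegral_pullback_pencil_of_not_dvd (p ^ a) t q hPpos hqP φ₀
  haveI : Nonempty ↥(pullback j b₁) := ⟨sqP'.isoPullback.inv (Classical.arbitrary _)⟩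
  haveI : IsIntegral (pullback j b₁) := isIntegral_of_isOpenImmersion sqP'.isoPullback.hom
  haveI : IsIntegral (pullback f' s₁) := isIntegral_of_flat_of_isPullback j b₁ sqP
  -- root descent: `φ₀ t = s ^ p ^ j'`, `X^p − s` irreducible, `a = m + 1 + j'`
  obtain ⟨m, j', s, ha, hs, hsirr⟩ := exists_root_irreducible p hp (φ₀ t) hroot
  have hpoly : TwistExponent.twistPoly K' (p ^ a) (φ₀ t) q 1 =
      TwistExponent.twistPoly K' (p ^ (m + 1)) s q (p ^ j') := by
    rw [ha, ← hs]; exact twistPoly_root_pow p q s m j'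
  let e := TwistExponent.twistCurveIsoOfEq K' q hpoly
  -- the twisted curve inside `X₁`, over `K'`
  obtain ⟨i, hidef⟩ : ∃ i : TwistExponent.twistCurve K' (p ^ (m + 1)) s q (p ^ j') ⟶ pullback f' s₁,
      i = e.inv ≫ (pullbackPencilIso A (p ^ a) t q φ₀).inv ≫ sqP'.isoPullback.inv ≫ pullback.snd j b₁ :=
    ⟨_, rfl⟩
  haveI : IsOpenImmersion i := by rw [hidef]; infer_instance
  have hi : i ≫ g = TwistExponent.twistCurveTo K' (p ^ (m + 1)) s q (p ^ j') := by
    rw [hidef, Category.assoc, Category.assoc, Category.assoc, Iso.inv_comp_eq, Iso.inv_comp_eq,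
      sqP'.isoPullback_inv_snd, TwistExponent.twistCurveIsoOfEq_hom_comp, pullbackPencilIso_hom_comp]
  -- the fibre over `s₂` is the base change of the fibre over `s₁`
  have sq₂ : IsPullback c₂ g₂ f' (sΩ ≫ s₁) := IsPullback.of_hasPullback f' (sΩ ≫ s₁)
  let x : pullback f' (sΩ ≫ s₁) ⟶ pullback f' s₁ :=
    pullback.lift c₂ (g₂ ≫ sΩ) (by rw [Category.assoc]; exact sq₂.w)
  have hx₁ : x ≫ c₁ = c₂ := pullback.lift_fst _ _ _
  have hx₂ : x ≫ g = g₂ ≫ sΩ := pullback.lift_snd _ _ _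
  have sqx : IsPullback x g₂ g sΩ := IsPullback.of_right (by rw [hx₁]; exact sq₂) hx₂ sq₁
  have sqY₁ : IsPullback (pullback.fst G c₁) π G c₁ := IsPullback.of_hasPullback G c₁
  have sqY₂ : IsPullback (pullback.fst G c₂) π₂ G c₂ := IsPullback.of_hasPullback G c₂
  let y : pullback G c₂ ⟶ pullback G c₁ :=
    pullback.lift (pullback.fst G c₂) (π₂ ≫ x) (by rw [Category.assoc, hx₁]; exact sqY₂.w)
  have hy₁ : y ≫ pullback.fst G c₁ = pullback.fst G c₂ := pullback.lift_fst _ _ _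
  have hy₂ : y ≫ π = π₂ ≫ x := pullback.lift_snd _ _ _
  have sqy : IsPullback y π₂ π x := IsPullback.of_right (by rw [hy₁, hx₁]; exact sqY₂) hy₂ sqY₁
  have sqyΩ : IsPullback y (π₂ ≫ g₂) (π ≫ g) sΩ := sqy.paste_vert sqx
  have hregΩ : Scheme.IsRegular (pullback (π ≫ g) sΩ) :=
    Literature.AlgebraicGeometry.Resolution.Scheme.IsRegular.of_iso sqyΩ.isoPullback.hom hreg₂
  -- conclude
  haveI := hproper
  haveI : LocallyOfFiniteType (π ≫ g) := inferInstance
  exact false_of_isRegular_pullback_proper_isoOver_pow K' p s q hqp hsirr m j' ι g i hi π W hW hiso hregΩ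

/-- **THE RESOLVING BASE MUST EXTRACT A `p^a`-TH ROOT OF THE PARAMETER** (twisted pencil `y^q = x^{p^a} − t`,
fibres formed literally as in `CampaignW82.FamilyResolution`): if some `G : 𝒴 → 𝒳 ×_A Spec A'` (`A → A'`
injective between domains of characteristic `p`) has both its fibre over the generic point and its fibre over the
geometric generic point of `Spec A'` weak resolutions, then `t` is a `p^a`-th power in `Frac A'`.
[cite: Kollar2007, 1.19] -/
theorem exists_pow_pow_eq_of_isWeakResolution_generic_fibres [Fact p.Prime] [Fact q.Prime] (hqp : q ≠ p) (a : ℕ)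
    [IsDomain A] [CharP A p]
    {𝒳 : Scheme.{0}} (f : 𝒳 ⟶ Spec (.of A)) [LocallyOfFiniteType f]
    (j : pencil A (p ^ a) t q ⟶ 𝒳) [IsOpenImmersion j] [QuasiCompact j] [IsSchemeTheoreticallyDominant j]
    (hj : j ≫ f = pencilTo A (p ^ a) t q)
    {A' : Type} [CommRing A'] [IsDomain A'] [Algebra A A'] (hinj : Function.Injective (algebraMap A A'))
    {𝒴 : Scheme.{0}} (G : 𝒴 ⟶ pullback f (Spec.map (CommRingCat.ofHom (algebraMap A A'))))
    (h₁ : IsWeakResolution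
      (pullback.snd G
        (pullback.fst (pullback.snd f (Spec.map (CommRingCat.ofHom (algebraMap A A'))))
          (Spec.map (CommRingCat.ofHom (algebraMap A' (FractionRing A')))))))
    (h₂ : IsWeakResolution
      (pullback.snd G
        (pullback.fst (pullback.snd f (Spec.map (CommRingCat.ofHom (algebraMap A A'))))
          (Spec.map (CommRingCat.ofHom ((algebraMap (FractionRing A') (AlgebraicClosure (FractionRing A'))).comp
            (algebraMap A' (FractionRing A')))))))) :
    ∃ s : FractionRing A', s ^ p ^ a = algebraMap A' (FractionRing A') (algebraMap A A' t) := by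
  by_contra hno
  haveI : CharP A' p := charP_of_injective_algebraMap hinj p
  haveI : CharP (FractionRing A') p :=
    charP_of_injective_algebraMap (IsFractionRing.injective A' (FractionRing A')) p
  have hflat : ((algebraMap A' (FractionRing A')).comp (algebraMap A A')).Flat :=
    ringHom_flat_of_injective_of_field _ ((IsFractionRing.injective A' (FractionRing A')).comp hinj)
  exact false_of_isWeakResolution_two_fibres_pow' p t q hqp a f j hj
    (Spec.map (CommRingCat.ofHom (algebraMap A A'))) ((algebraMap A' (FractionRing A')).comp (algebraMap A A'))
    (algebraMap (FractionRing A') (AlgebraicClosure (FractionRing A')))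
    (Spec.map (CommRingCat.ofHom (algebraMap A' (FractionRing A'))))
    (by rw [← Spec.map_comp, ← CommRingCat.ofHom_comp]) _
    (by rw [← Spec.map_comp, ← CommRingCat.ofHom_comp]) hflat (fun s hs => hno ⟨s, hs⟩) G h₁ h₂

end TwoFibresPow

/-! ## §3 No bound on the inseparable exponent of resolving base extensions -/

section Unbounded

/-- **THE INSEPARABLE EXPONENT OF RESOLVING BASE EXTENSIONS IS UNBOUNDED** — for every field `k` of
characteristic `p > 0` and every `e : ℕ` there is a PROPER family `f : 𝒳 → Spec k[t]` with INTEGRAL geometric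
generic fibre of DIMENSION `≤ 1` (so within the hypothesis class of `CampaignW82.FamilyResolution(DimLe · 1)`, which
HOLDS for it — `familyResolutionDimLe_one`, p531789) such that: for EVERY injective `k[t] → A'` into a domain and
EVERY `G : 𝒴 → 𝒳 ×_{k[t]} Spec A'` whose fibres over the generic and the geometric generic point of `Spec A'` are weak
resolutions, `t` is a `p^{e+1}`-th power in `Frac A'`. The family is the compactified twisted Kollár pencil
`y^q = x^{p^{e+1}} − t` (`q = altPrime p`); `exists_pow_pow_eq_of_isWeakResolution_generic_fibres`. So no uniform
bound on the inseparable exponent `[Frac A' : k(t)]_i` of the base extension in resolution in families holds across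
families of curves over `k[t]` — the family-level form of gen 3's «no bounded Frobenius-twist exponent» (p510058).
[cite: Kollar2007, 1.19] -/
theorem inseparable_exponent_unbounded (k : Type) [Field k] (p : ℕ) [Fact p.Prime] [CharP k p] (e : ℕ) :
    ∃ (𝒳 : Scheme.{0}) (f : 𝒳 ⟶ Spec (.of k[X])), IsProper f ∧
      IsIntegral (pullback f (Spec.map (CommRingCat.ofHom
        (algebraMap k[X] (AlgebraicClosure (FractionRing k[X])))))) ∧
      topologicalKrullDim ↥(pullback f (Spec.map (CommRingCat.ofHom
        (algebraMap k[X] (AlgebraicClosure (FractionRing k[X])))))) ≤ 1 ∧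
      ∀ (A' : Type) [CommRing A'] [IsDomain A'] [Algebra k[X] A'], Function.Injective (algebraMap k[X] A') →
        ∀ (𝒴 : Scheme.{0}) (G : 𝒴 ⟶ pullback f (Spec.map (CommRingCat.ofHom (algebraMap k[X] A')))),
          IsWeakResolution
            (pullback.snd G
              (pullback.fst (pullback.snd f (Spec.map (CommRingCat.ofHom (algebraMap k[X] A'))))
                (Spec.map (CommRingCat.ofHom (algebraMap A' (FractionRing A')))))) →
          IsWeakResolution
            (pullback.snd G
              (pullback.fst (pullback.snd f (Spec.map (CommRingCat.ofHom (algebraMap k[X] A'))))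
                (Spec.map (CommRingCat.ofHom
                  ((algebraMap (FractionRing A') (AlgebraicClosure (FractionRing A'))).comp
                    (algebraMap A' (FractionRing A'))))))) →
          ∃ s : FractionRing A', s ^ p ^ (e + 1) = algebraMap A' (FractionRing A') (algebraMap k[X] A' Polynomial.X) := by
  have hp : p.Prime := Fact.out
  let q := TwistExponent.altPrime p
  haveI : Fact q.Prime := ⟨TwistExponent.altPrime_prime p⟩
  have hqp : q ≠ p := TwistExponent.altPrime_ne hp
  have hqP : ¬ q ∣ p ^ (e + 1) := TwistExponent.not_altPrime_dvd hp (e + 1)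
  haveI : CharP k[X] p := inferInstance
  obtain ⟨𝒳, f, j, hf, hj, hqc, hdom, hjf⟩ := exists_compactifiedPencil k[X] (p ^ (e + 1)) Polynomial.X q
  haveI := hf
  haveI := hj
  haveI := hqc
  haveI := hdom
  have hΩinj : Function.Injective (algebraMap k[X] (AlgebraicClosure (FractionRing k[X]))) := by
    rw [IsScalarTower.algebraMap_eq k[X] (FractionRing k[X]) (AlgebraicClosure (FractionRing k[X]))]
    exact (algebraMap (FractionRing k[X]) _).injective.comp (IsFractionRing.injective k[X] (FractionRing k[X]))
  obtain ⟨hint, hdim⟩ := isIntegral_and_dim_le_one_of_pencil_dense (p ^ (e + 1)) Polynomial.X q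
    (pow_pos hp.pos _) hqP f j hjf _ (ringHom_flat_of_injective_of_field _ hΩinj)
  refine ⟨𝒳, f, hf, hint, hdim, ?_⟩
  intro A' _ _ _ hinj 𝒴 G h₁ h₂
  exact exists_pow_pow_eq_of_isWeakResolution_generic_fibres p Polynomial.X q hqp (e + 1) f j hjf hinj G h₁ h₂

end Unbounded

end Summit.ResolutionOfSingularities.ResolutionOfSingularities.Theorems.CampaignW82.SeparableTightness

end
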